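import Mathlib
import Summits.ValiantsHypothesis.ValiantsHypothesis.Theorems.KPlusLogSqLawLiftingFiniteBaseTieMass

/-!
# Patchworking at finite base, chord margins (part 2): bookkeeping — the competitors of a window weigh at most `b^{−M}(T₁ + T₂)`

HONEST FRAMING.  Helper file toward the lifting crux `WeakLifting` (stmt-ValiantsHypothesis-19561; aside `Lifting`
stmt-ValiantsHypothesis-19772, registered stub `stub_liftThin`) of route `KPlusLogSqLaw` (cell `pub-symmetroid`, seat
val-sym-lift-p1 g9, 2026-08-27).  Bookkeeping for part 3 (`…LiftingFiniteBaseChordMargin`: the exact window under a chord margin); nothing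
here asserts `WeakLifting`, `TropicalB`, Conjecture B, `MatrixDescartes` (stmt-ValiantsHypothesis-18050) or anything about VP ≠ VNP.

CONTENT (design `(d, v, ε)`, base `b > 1`, `f_b = det Σ_l X^{d_l} patchMatrix b v ε l`, Leibniz terms `q` with mass `T_q(x) = b^{−V(q)} x^{D(q)}`
at a real point `x > 0`, `N = m!·K^m`):
* `lt_of_ratio_le_of_le_ratio` — points are ordered by the ratio of two monomial masses;
* `vertex_mass_sub_le_abs_coeff_mul_pow` — `|c_{D(P)}| x^{D(P)} ≥ T_P(x) − Σ_{q ≠ P, D q = D P} T_q(x)`;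
* `sum_le_vertex_add_others`, `sum_le_others` — splitting a term sum that avoids one (both) of two vertices `p₁ ≠ p₂`;
* `others_mass_le_of_chordMargin` — THE COMPETITOR BOUND: if `p₁`, `p₂` are dominant with margin `M` at the integer slopes `θ₁`, `θ₂` and
  every present term of slope strictly between `D(p₁)` and `D(p₂)` lies below the CHORD of `(p₁, p₂)` by `M`
  (`V(p₁)(D(p₂)−D(q)) + V(p₂)(D(q)−D(p₁)) + M(D(p₂)−D(p₁)) ≤ V(q)(D(p₂)−D(p₁))`), then at every `x ∈ [b^{θ₁}, b^{θ₂}]` and for every weight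
  `φ ≤ Φ` on present slopes, `Σ_{q ∉ {p₁,p₂}} φ(D q) T_q(x) ≤ N Φ b^{−M} (T_{p₁}(x) + T_{p₂}(x))` — terms of slope `≤ D(p₁)` / `≥ D(p₂)` by
  the integer-slope margins and ratio monotonicity, hidden terms by the chord bound of part 1.
No `def`.  [folklore]
-/

set_option linter.dupNamespace false
set_option autoImplicit false

namespace Summit.ValiantsHypothesis.ValiantsHypothesis.Theorems.KPlusLogSqLaw.LocalDescartes

open Polynomial Finset
open scoped BigOperators
open Summit.ValiantsHypothesis.ValiantsHypothesis.Theorems.MatrixDescartes.Negative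
  (patchMatrix tropWeight termSign abs_termSign_eq_one)
open Summit.ValiantsHypothesis.ValiantsHypothesis.Theorems.KPlusLogSqLaw.ExactPatchwork (coeff_det_patch_eq_sum_filter)

variable {m K : ℕ}

/-- points are ordered by their ratios (inequality form): `C₂ x^{e+n} ≤ ρ C₁ x^e`, `ρ' C₁ y^e ≤ C₂ y^{e+n}`, `ρ < ρ'` ⇒ `x < y`. [folklore] -/
theorem lt_of_ratio_le_of_le_ratio {C₁ C₂ ρ ρ' x y : ℝ} (hC₁ : 0 < C₁) (hC₂ : 0 < C₂) (hx : 0 < x) (hy : 0 < y) (e : ℕ) {n : ℕ}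
    (hxρ : C₂ * x ^ (e + n) ≤ ρ * (C₁ * x ^ e)) (hyρ : ρ' * (C₁ * y ^ e) ≤ C₂ * y ^ (e + n)) (hρ : ρ < ρ') :
    x < y := by
  by_contra hcon
  push Not at hcon
  have hyn : y ^ n ≤ x ^ n := pow_le_pow_left₀ hy.le hcon n
  have h1 : ρ' * C₁ ≤ C₂ * y ^ n := by
    have h := hyρ
    rw [pow_add] at h
    have e1 : C₂ * (y ^ e * y ^ n) = (C₂ * y ^ n) * y ^ e := by ring
    have e2 : ρ' * (C₁ * y ^ e) = (ρ' * C₁) * y ^ e := by ring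
    rw [e1, e2] at h
    exact le_of_mul_le_mul_right h (pow_pos hy _)
  have h2 : C₂ * x ^ n ≤ ρ * C₁ := by
    have h := hxρ
    rw [pow_add] at h
    have e1 : C₂ * (x ^ e * x ^ n) = (C₂ * x ^ n) * x ^ e := by ring
    have e2 : ρ * (C₁ * x ^ e) = (ρ * C₁) * x ^ e := by ring
    rw [e1, e2] at h
    exact le_of_mul_le_mul_right h (pow_pos hx _)
  have h3 : ρ' * C₁ ≤ ρ * C₁ :=
    h1.trans ((mul_le_mul_of_nonneg_left hyn hC₂.le).trans h2)
  exact absurd hρ (not_lt.mpr (le_of_mul_le_mul_right h3 hC₁))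

/-- **the vertex coefficient at a real point**: `|c_{D(P)}| x^{D(P)} ≥ T_P(x) − Σ_{q ≠ P, D q = D P} T_q(x)`. [folklore] -/
theorem vertex_mass_sub_le_abs_coeff_mul_pow (b : ℝ) (hb : 0 < b) (d : Fin K → ℕ) (v ε : Fin m → Fin m → Fin K → ℤ)
    (hε : ∀ i j l, (ε i j l).natAbs ≤ 1) (P : Equiv.Perm (Fin m) × (Fin m → Fin K)) (hP : termSign ε P ≠ 0) {x : ℝ} (hx : 0 < x) :
    b ^ (-(∑ i, v (P.1 i) i (P.2 i))) * x ^ (∑ i, d (P.2 i))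
        - ∑ q ∈ (Finset.univ.erase P).filter (fun q => (∑ i, d (q.2 i)) = ∑ i, d (P.2 i)),
            |(termSign ε q : ℝ)| * b ^ (-(∑ i, v (q.1 i) i (q.2 i))) * x ^ (∑ i, d (q.2 i))
      ≤ |((∑ l, (X : ℝ[X]) ^ d l • (patchMatrix b v ε l).map C).det).coeff (∑ i, d (P.2 i))| * x ^ (∑ i, d (P.2 i)) := by
  classical
  set DP := ∑ i, d (P.2 i) with hDP
  have hid : ((∑ l, (X : ℝ[X]) ^ d l • (patchMatrix b v ε l).map C).det).coeff DP * x ^ DP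
      = (termSign ε P : ℝ) * b ^ (-(∑ i, v (P.1 i) i (P.2 i))) * x ^ DP
        + ∑ q ∈ (Finset.univ.erase P).filter (fun q => (∑ i, d (q.2 i)) = DP),
            (termSign ε q : ℝ) * b ^ (-(∑ i, v (q.1 i) i (q.2 i))) * x ^ (∑ i, d (q.2 i)) := by
    rw [coeff_det_patch_eq_sum_filter b hb, Finset.sum_mul]
    have hP' : P ∈ Finset.univ.filter (fun q : Equiv.Perm (Fin m) × (Fin m → Fin K) => (∑ i, d (q.2 i)) = DP) :=
      Finset.mem_filter.mpr ⟨Finset.mem_univ _, rfl⟩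
    rw [← Finset.add_sum_erase _ _ hP', Finset.filter_erase]
    congr 1
    refine Finset.sum_congr rfl fun q hq => ?_
    have hD : (∑ i, d (q.2 i)) = DP := (Finset.mem_filter.mp (Finset.mem_of_mem_erase hq)).2
    rw [hD]
  have hgoal : |((∑ l, (X : ℝ[X]) ^ d l • (patchMatrix b v ε l).map C).det).coeff DP| * x ^ DP
      = |((∑ l, (X : ℝ[X]) ^ d l • (patchMatrix b v ε l).map C).det).coeff DP * x ^ DP| := by
    rw [abs_mul, abs_of_nonneg (pow_nonneg hx.le DP)]
  rw [hgoal, hid]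
  have hmain : |(termSign ε P : ℝ) * b ^ (-(∑ i, v (P.1 i) i (P.2 i))) * x ^ DP| = b ^ (-(∑ i, v (P.1 i) i (P.2 i))) * x ^ DP := by
    rw [abs_mul, abs_mul, abs_termSign_eq_one ε hε P hP, one_mul, abs_of_pos (zpow_pos hb _), abs_of_nonneg (pow_nonneg hx.le _)]
  have hR : |∑ q ∈ (Finset.univ.erase P).filter (fun q => (∑ i, d (q.2 i)) = DP),
      (termSign ε q : ℝ) * b ^ (-(∑ i, v (q.1 i) i (q.2 i))) * x ^ (∑ i, d (q.2 i))|
      ≤ ∑ q ∈ (Finset.univ.erase P).filter (fun q => (∑ i, d (q.2 i)) = DP),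
          |(termSign ε q : ℝ)| * b ^ (-(∑ i, v (q.1 i) i (q.2 i))) * x ^ (∑ i, d (q.2 i)) := by
    refine (Finset.abs_sum_le_sum_abs _ _).trans (le_of_eq (Finset.sum_congr rfl fun q _ => ?_))
    rw [abs_mul, abs_mul, abs_of_pos (zpow_pos hb _), abs_of_nonneg (pow_nonneg hx.le _)]
  have htri := abs_sub_abs_le_abs_add ((termSign ε P : ℝ) * b ^ (-(∑ i, v (P.1 i) i (P.2 i))) * x ^ DP)
    (∑ q ∈ (Finset.univ.erase P).filter (fun q => (∑ i, d (q.2 i)) = DP),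
      (termSign ε q : ℝ) * b ^ (-(∑ i, v (q.1 i) i (q.2 i))) * x ^ (∑ i, d (q.2 i)))
  rw [hmain] at htri
  linarith

/-- a term sum avoiding one of two vertices `p₁ ≠ p₂` is at most the other vertex's term plus the sum over all remaining terms
(non-negative summands). [folklore] -/
theorem sum_le_vertex_add_others (F : Equiv.Perm (Fin m) × (Fin m → Fin K) → ℝ) (hF : ∀ q, 0 ≤ F q)
    {p₁ p₂ : Equiv.Perm (Fin m) × (Fin m → Fin K)} (hne : p₁ ≠ p₂) (P₀ Q₀ : Equiv.Perm (Fin m) × (Fin m → Fin K))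
    (hPQ : (p₁ = P₀ ∧ p₂ = Q₀) ∨ (p₂ = P₀ ∧ p₁ = Q₀)) (S : Finset (Equiv.Perm (Fin m) × (Fin m → Fin K))) (hS : P₀ ∉ S) :
    ∑ q ∈ S, F q ≤ F Q₀ + ∑ q ∈ (Finset.univ.erase p₁).erase p₂, F q := by
  classical
  have hne' : Q₀ ≠ P₀ := by
    rcases hPQ with ⟨h1, h2⟩ | ⟨h1, h2⟩
    · rw [← h1, ← h2]; exact Ne.symm hne
    · rw [← h1, ← h2]; exact hne
  have hset : (Finset.univ.erase P₀).erase Q₀ = (Finset.univ.erase p₁).erase p₂ := by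
    rcases hPQ with ⟨h1, h2⟩ | ⟨h1, h2⟩
    · rw [← h1, ← h2]
    · rw [← h1, ← h2, Finset.erase_right_comm]
  have hsub : S ⊆ Finset.univ.erase P₀ := fun q hq => Finset.mem_erase.mpr ⟨fun h => hS (h ▸ hq), Finset.mem_univ _⟩
  calc ∑ q ∈ S, F q ≤ ∑ q ∈ Finset.univ.erase P₀, F q :=
        Finset.sum_le_sum_of_subset_of_nonneg hsub (fun q _ _ => hF q)
    _ = F Q₀ + ∑ q ∈ (Finset.univ.erase P₀).erase Q₀, F q :=
        (Finset.add_sum_erase _ _ (Finset.mem_erase.mpr ⟨hne', Finset.mem_univ _⟩)).symm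
    _ = F Q₀ + ∑ q ∈ (Finset.univ.erase p₁).erase p₂, F q := by rw [hset]

/-- a term sum avoiding both vertices is at most the sum over all remaining terms (non-negative summands). [folklore] -/
theorem sum_le_others (F : Equiv.Perm (Fin m) × (Fin m → Fin K) → ℝ) (hF : ∀ q, 0 ≤ F q)
    (p₁ p₂ : Equiv.Perm (Fin m) × (Fin m → Fin K)) (S : Finset (Equiv.Perm (Fin m) × (Fin m → Fin K)))
    (hS1 : p₁ ∉ S) (hS2 : p₂ ∉ S) :
    ∑ q ∈ S, F q ≤ ∑ q ∈ (Finset.univ.erase p₁).erase p₂, F q := by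
  classical
  refine Finset.sum_le_sum_of_subset_of_nonneg (fun q hq => ?_) (fun q _ _ => hF q)
  exact Finset.mem_erase.mpr ⟨fun h => hS2 (h ▸ hq), Finset.mem_erase.mpr ⟨fun h => hS1 (h ▸ hq), Finset.mem_univ _⟩⟩

/-- **THE COMPETITOR BOUND UNDER A CHORD MARGIN.**  If `p₁`, `p₂` are dominant with margin `M` at the integer slopes `θ₁`, `θ₂` and every
present term of slope strictly between `D(p₁)` and `D(p₂)` lies below the chord of `(p₁, p₂)` by `M`, then at every real point
`x ∈ [b^{θ₁}, b^{θ₂}]` every other term weighs at most `b^{−M}(T_{p₁}(x) + T_{p₂}(x))`; summed with weights `0 ≤ φ ≤ Φ`: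
`Σ_{q ∉ {p₁,p₂}} φ(D q)|termSign q| b^{−V q} x^{D q} ≤ N Φ b^{−M} (T_{p₁}(x) + T_{p₂}(x))`. [folklore] -/
theorem others_mass_le_of_chordMargin (b : ℝ) (hb : 1 < b) (d : Fin K → ℕ) (v ε : Fin m → Fin m → Fin K → ℤ)
    (hε : ∀ i j l, (ε i j l).natAbs ≤ 1) (M : ℕ) {θ₁ θ₂ : ℤ} (p₁ p₂ : Equiv.Perm (Fin m) × (Fin m → Fin K))
    (hmar₁ : ∀ q, q ≠ p₁ → termSign ε q ≠ 0 → tropWeight d v θ₁ q + M ≤ tropWeight d v θ₁ p₁)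
    (hmar₂ : ∀ q, q ≠ p₂ → termSign ε q ≠ 0 → tropWeight d v θ₂ q + M ≤ tropWeight d v θ₂ p₂)
    (hchord : ∀ q : Equiv.Perm (Fin m) × (Fin m → Fin K), termSign ε q ≠ 0 →
      (∑ i, d (p₁.2 i)) < (∑ i, d (q.2 i)) → (∑ i, d (q.2 i)) < (∑ i, d (p₂.2 i)) →
      (∑ i, v (p₁.1 i) i (p₁.2 i)) * (((∑ i, d (p₂.2 i) : ℕ) : ℤ) - ((∑ i, d (q.2 i) : ℕ) : ℤ))
        + (∑ i, v (p₂.1 i) i (p₂.2 i)) * (((∑ i, d (q.2 i) : ℕ) : ℤ) - ((∑ i, d (p₁.2 i) : ℕ) : ℤ))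
        + (M : ℤ) * (((∑ i, d (p₂.2 i) : ℕ) : ℤ) - ((∑ i, d (p₁.2 i) : ℕ) : ℤ))
        ≤ (∑ i, v (q.1 i) i (q.2 i)) * (((∑ i, d (p₂.2 i) : ℕ) : ℤ) - ((∑ i, d (p₁.2 i) : ℕ) : ℤ)))
    {x : ℝ} (hax : b ^ θ₁ ≤ x) (hxc : x ≤ b ^ θ₂) (φ : ℕ → ℝ) (Φ : ℝ) (hΦ : 0 ≤ Φ)
    (hφΦ : ∀ q : Equiv.Perm (Fin m) × (Fin m → Fin K), termSign ε q ≠ 0 → φ (∑ i, d (q.2 i)) ≤ Φ) :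
    ∑ q ∈ (Finset.univ.erase p₁).erase p₂, φ (∑ i, d (q.2 i)) * |(termSign ε q : ℝ)| * b ^ (-(∑ i, v (q.1 i) i (q.2 i)))
        * x ^ (∑ i, d (q.2 i))
      ≤ (Fintype.card (Equiv.Perm (Fin m) × (Fin m → Fin K)) : ℝ) * Φ * (b ^ (M : ℤ))⁻¹
        * (b ^ (-(∑ i, v (p₁.1 i) i (p₁.2 i))) * x ^ (∑ i, d (p₁.2 i)) + b ^ (-(∑ i, v (p₂.1 i) i (p₂.2 i))) * x ^ (∑ i, d (p₂.2 i))) := by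
  classical
  have hb0 : 0 < b := lt_trans one_pos hb
  set N : ℕ := Fintype.card (Equiv.Perm (Fin m) × (Fin m → Fin K)) with hNdef
  set D₁ := ∑ i, d (p₁.2 i) with hD₁
  set D₂ := ∑ i, d (p₂.2 i) with hD₂
  set V₁ := ∑ i, v (p₁.1 i) i (p₁.2 i) with hV₁
  set V₂ := ∑ i, v (p₂.1 i) i (p₂.2 i) with hV₂
  set η : ℝ := (b ^ (M : ℤ))⁻¹ with hη
  set T : Equiv.Perm (Fin m) × (Fin m → Fin K) → ℝ → ℝ :=
    fun q x => b ^ (-(∑ i, v (q.1 i) i (q.2 i))) * x ^ (∑ i, d (q.2 i)) with hT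
  have ha0 : 0 < b ^ θ₁ := zpow_pos hb0 _
  have hη0 : 0 < η := by rw [hη]; exact inv_pos.mpr (zpow_pos hb0 _)
  have hx0 : 0 < x := lt_of_lt_of_le ha0 hax
  have hT1 : 0 ≤ T p₁ x := by simp only [hT]; exact mul_nonneg (zpow_pos hb0 _).le (pow_nonneg hx0.le _)
  have hT2 : 0 ≤ T p₂ x := by simp only [hT]; exact mul_nonneg (zpow_pos hb0 _).le (pow_nonneg hx0.le _)
  have hothers : ∀ q : Equiv.Perm (Fin m) × (Fin m → Fin K), termSign ε q ≠ 0 →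
      q ≠ p₁ → q ≠ p₂ → T q x ≤ η * (T p₁ x + T p₂ x) := by
    intro q hq hq1 hq2
    by_cases hlow : (∑ i, d (q.2 i)) ≤ D₁
    · -- slope `≤ D₁`: beaten at `θ₁`, stays beaten to the right
      have h := mass_le_of_margin_low b hb d v θ₁ M p₁ q hlow (hmar₁ q hq1 hq) hax
      simp only [hT]
      calc _ ≤ η * T p₁ x := by simp only [hT, hη]; exact h
        _ ≤ η * (T p₁ x + T p₂ x) := by nlinarith
    by_cases hhigh : D₂ ≤ (∑ i, d (q.2 i))
    · have h := mass_le_of_margin_high b hb d v θ₂ M p₂ q hhigh (hmar₂ q hq2 hq) hx0 hxc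
      simp only [hT]
      calc _ ≤ η * T p₂ x := by simp only [hT, hη]; exact h
        _ ≤ η * (T p₁ x + T p₂ x) := by nlinarith
    -- hidden slope: the chord bound
    push Not at hlow hhigh
    obtain ⟨j, hj⟩ : ∃ j, (∑ i, d (q.2 i)) = D₁ + j := ⟨(∑ i, d (q.2 i)) - D₁, by omega⟩
    obtain ⟨i, hi⟩ : ∃ i, D₂ = D₁ + (i + j) := ⟨D₂ - (∑ l, d (q.2 l)), by omega⟩
    have hij : i + j ≠ 0 := by omega
    have hch := hchord q hq hlow hhigh
    have hch' : V₁ * (i : ℤ) + V₂ * (j : ℤ) + (M : ℤ) * ((i : ℤ) + j) ≤ (∑ l, v (q.1 l) l (q.2 l)) * ((i : ℤ) + j) := by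
      have e1 : ((D₂ : ℕ) : ℤ) - ((∑ l, d (q.2 l) : ℕ) : ℤ) = (i : ℤ) := by rw [hi, hj]; push_cast; ring
      have e2 : ((∑ l, d (q.2 l) : ℕ) : ℤ) - ((D₁ : ℕ) : ℤ) = (j : ℤ) := by rw [hj]; push_cast; ring
      have e3 : ((D₂ : ℕ) : ℤ) - ((D₁ : ℕ) : ℤ) = (i : ℤ) + j := by rw [hi]; push_cast; ring
      rw [e1, e2, e3] at hch
      exact hch
    have h := mass_le_max_of_chordMargin b hb d v M p₁ p₂ q hij hj hi hch' hx0
    have hmax : max (T p₁ x) (T p₂ x) ≤ T p₁ x + T p₂ x := max_le (by linarith) (by linarith)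
    simp only [hT]
    calc _ ≤ η * max (T p₁ x) (T p₂ x) := by simp only [hT, hη]; exact h
      _ ≤ η * (T p₁ x + T p₂ x) := mul_le_mul_of_nonneg_left hmax hη0.le
  -- summed, with weights `φ(D q) ≤ Φ`
  have hT12 : 0 ≤ T p₁ x + T p₂ x := add_nonneg hT1 hT2
  have hterm : ∀ q ∈ (Finset.univ.erase p₁).erase p₂,
      φ (∑ i, d (q.2 i)) * |(termSign ε q : ℝ)| * b ^ (-(∑ i, v (q.1 i) i (q.2 i))) * x ^ (∑ i, d (q.2 i))
        ≤ Φ * η * (T p₁ x + T p₂ x) := by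
    intro q hq
    have hq2 : q ≠ p₂ := (Finset.mem_erase.mp hq).1
    have hq1 : q ≠ p₁ := (Finset.mem_erase.mp (Finset.mem_erase.mp hq).2).1
    by_cases hz : termSign ε q = 0
    · rw [hz, Int.cast_zero, abs_zero, mul_zero, zero_mul, zero_mul]
      exact mul_nonneg (mul_nonneg hΦ hη0.le) hT12
    · rw [abs_termSign_eq_one ε hε q hz, mul_one, mul_assoc]
      have h1 := hothers q hz hq1 hq2
      simp only [hT] at h1 ⊢
      calc φ (∑ i, d (q.2 i)) * (b ^ (-(∑ i, v (q.1 i) i (q.2 i))) * x ^ (∑ i, d (q.2 i)))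
          ≤ Φ * (η * (b ^ (-(∑ i, v (p₁.1 i) i (p₁.2 i))) * x ^ (∑ i, d (p₁.2 i))
            + b ^ (-(∑ i, v (p₂.1 i) i (p₂.2 i))) * x ^ (∑ i, d (p₂.2 i)))) :=
            mul_le_mul (hφΦ q hz) h1 (mul_nonneg (zpow_pos hb0 _).le (pow_nonneg hx0.le _)) hΦ
        _ = Φ * η * _ := by ring
  calc ∑ q ∈ (Finset.univ.erase p₁).erase p₂, φ (∑ i, d (q.2 i)) * |(termSign ε q : ℝ)|
        * b ^ (-(∑ i, v (q.1 i) i (q.2 i))) * x ^ (∑ i, d (q.2 i))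
      ≤ ∑ _q ∈ (Finset.univ.erase p₁).erase p₂, Φ * η * (T p₁ x + T p₂ x) := Finset.sum_le_sum hterm
    _ = (((Finset.univ.erase p₁).erase p₂).card : ℝ) * (Φ * η * (T p₁ x + T p₂ x)) := by
        rw [Finset.sum_const, nsmul_eq_mul]
    _ ≤ (N : ℝ) * (Φ * η * (T p₁ x + T p₂ x)) := by
        refine mul_le_mul_of_nonneg_right ?_ (mul_nonneg (mul_nonneg hΦ hη0.le) hT12)
        rw [hNdef]; exact_mod_cast Finset.card_le_univ _
    _ = (N : ℝ) * Φ * η * (T p₁ x + T p₂ x) := by ring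

end Summit.ValiantsHypothesis.ValiantsHypothesis.Theorems.KPlusLogSqLaw.LocalDescartes
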